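import Mathlib
import HarnessLib
import Literature.Barriers.ValiantsHypothesis.GCTMatrixPoweringCor9
import Summits.ValiantsHypothesis.ValiantsHypothesis.Theorems.SchenstedIndexBorderPcPerThreeGeom

/-!
# Route SchenstedIndex — `pc(per_3) ≥ 4` in the tree's currency `powTraceComplexity`

Leaf corollary of `Theorems/SchenstedIndexBorderPcPerThreeGeom.lean` (border power-trace complexity
of `per_3` is at least `4`, by orbit dimensions) in the vocabulary of
`Literature/Barriers/ValiantsHypothesis/GCTMatrixPowering.lean` (Gesmundo–Ikenmeyer–Panova 2017 §2.2:
`HasPowTraceRepr k f n m` — `f = tr(A^n)` for an `m × m` matrix `A` of homogeneous linear forms —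
and `powTraceComplexity k f n = sInf {m | HasPowTraceRepr k f n m}`):

* `not_hasPowTraceRepr_perPoly_three_of_le_three` — no power-trace representation of `per_3` of
  width `≤ 3` (widths `< 3` are padded by a zero block to width `3`, then
  `not_exists_tracePow_three_repr_perPoly_three`);
* **`four_le_powTraceComplexity_perPoly_three`** — `4 ≤ pc(per_3)` (the infimum is over a nonempty
  set by the tree's `exists_hasPowTraceRepr_perPoly`).

This file imports a `Literature.Barriers.*` module for the DEFINITIONS `HasPowTraceRepr` /
`powTraceComplexity` only; it is a leaf (nothing in route SchenstedIndex's deciding cone imports it).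
HONEST FRAMING: a toy-size calibration (`pc(per_3) ∈ [4, 7]`); nothing here bears on `VP ≠ VNP`.
-/

set_option linter.dupNamespace false

noncomputable section

namespace Summit.ValiantsHypothesis.ValiantsHypothesis.Theorems.SchenstedIndex

open MvPolynomial Matrix
open Literature.Computability.AlgebraicComplexity
open Literature.Barriers.ValiantsHypothesis

/-- Powers of a block-diagonal matrix with a zero block. -/
theorem fromBlocks_zero_pow {ι κ R : Type*} [Fintype ι] [Fintype κ] [DecidableEq ι] [DecidableEq κ]
    [CommRing R] (A : Matrix ι ι R) (k : ℕ) :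
    (Matrix.fromBlocks A 0 0 (0 : Matrix κ κ R)) ^ k =
      Matrix.fromBlocks (A ^ k) 0 0 ((0 : Matrix κ κ R) ^ k) := by
  induction k with
  | zero => simp
  | succ k ih =>
      rw [pow_succ, ih, Matrix.fromBlocks_multiply]
      simp [pow_succ]

/-- **No power-trace representation of `per_3` of width `≤ 3`.** A representation of width `m ≤ 3`
is padded by a zero block to one of width `3` (the trace of the cube is unchanged), which
`not_exists_tracePow_three_repr_perPoly_three` excludes. -/
theorem not_hasPowTraceRepr_perPoly_three_of_le_three {m : ℕ} (hm : m ≤ 3) :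
    ¬ HasPowTraceRepr ℂ (perPoly (Fin 3) ℂ) 3 m := by
  rintro ⟨A, hA, htr⟩
  apply not_exists_tracePow_three_repr_perPoly_three
  -- pad `A` to a `3 × 3` matrix
  let e : Fin m ⊕ Fin (3 - m) ≃ Fin 3 := finSumFinEquiv.trans (finCongr (by omega))
  let P : Matrix (Fin m ⊕ Fin (3 - m)) (Fin m ⊕ Fin (3 - m)) (MvPolynomial (Fin 3 × Fin 3) ℂ) :=
    Matrix.fromBlocks A 0 0 0
  refine ⟨Matrix.reindexAlgEquiv ℂ _ e P, ?_, ?_⟩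
  · intro i j
    rw [Matrix.coe_reindexAlgEquiv, Matrix.reindex_apply, Matrix.submatrix_apply]
    rcases e.symm i with a | a <;> rcases e.symm j with b | b
    · simpa [P] using hA a b
    · simpa [P] using isHomogeneous_zero (Fin 3 × Fin 3) ℂ 1
    · simpa [P] using isHomogeneous_zero (Fin 3 × Fin 3) ℂ 1
    · simpa [P] using isHomogeneous_zero (Fin 3 × Fin 3) ℂ 1
  · have htrace : ∀ (Y : Matrix (Fin m) (Fin m) (MvPolynomial (Fin 3 × Fin 3) ℂ))
        (W : Matrix (Fin (3 - m)) (Fin (3 - m)) (MvPolynomial (Fin 3 × Fin 3) ℂ)),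
        (Matrix.fromBlocks Y 0 0 W).trace = Y.trace + W.trace := by
      intro Y W
      simp [Matrix.trace, Fintype.sum_sum_type]
    rw [← map_pow, Matrix.coe_reindexAlgEquiv, trace_reindex, ← htr, fromBlocks_zero_pow A 3, htrace]
    simp

/-- **`pc(per_3) ≥ 4`**: the power-trace complexity of `per_3` (Gesmundo–Ikenmeyer–Panova 2017 §2.2,
the tree's `powTraceComplexity`) is at least `4`. -/
theorem four_le_powTraceComplexity_perPoly_three :
    4 ≤ powTraceComplexity ℂ (perPoly (Fin 3) ℂ) 3 := by
  unfold powTraceComplexity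
  obtain ⟨N₀, hN₀⟩ := exists_hasPowTraceRepr_perPoly 3
  refine le_csInf ⟨N₀, hN₀⟩ fun m hm => ?_
  by_contra h
  exact not_hasPowTraceRepr_perPoly_three_of_le_three (by omega) hm

end Summit.ValiantsHypothesis.ValiantsHypothesis.Theorems.SchenstedIndex

end
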